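import Mathlib
import HarnessLib
import Summits.HubbardSuperconductivity.HubbardSuperconductivity.Theorems.KLProgrammeC4aUmkLoopCircleCanonicalMiddle
import Summits.HubbardSuperconductivity.HubbardSuperconductivity.Theorems.KLProgrammeC4aPPKernelMidLawBundle

/-!
# Route `KLProgramme` — crux C4a, S3 brick (B4) «(B4)-UMK1», «(U1)-M-LAW» kernel side, part H8: `umkLoopCircle_integral_ppMidSSplit_le_canonical`

Cell `gate-hubbard-kl`, seat hubbard-kl-k3c3-p1 (g18; row «δμ-flow with klAngularMean constant piece»), owner split (R321)(B): the law chain is k3c3-p3's (g34/g35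
`…Middle` files), the kernel side this seat's.  ONE PARTITION `P = A_s + swap A_s + M_s` (p704596): **`umkLoopCircle_integral_ppMidSSplit_le_canonical`** = `umkLoopCircle_integral_ppMidS_le_canonical` at `sκ := ppSplitProfile t₁`, `C := Cᴹ(B₁,B₂,B₃,t₁)` (`ppSplit_rowConstsMidS`): kernel inputs `βT Λ B₁ B₂ B₃ t₁ lo` only
(zero kernel rows).  Generated from the tree text by HOME/hubbard-kl-k3c3-p1/g17-gen_midS.py.
Pure real analysis on Literature objects; nothing asserts (C), K3, the window or superconductivity.
References: BGM 2006 §2.4 (2.36) [cite: BenfattoGiulianiMastropietro2006]; FST II CPAM 51 (1998) §3 [cite: FeldmanSalmhoferTrubowitz1998].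
-/

noncomputable section

namespace Summit.HubbardSuperconductivity.HubbardSuperconductivity.Theorems.C4a

set_option linter.dupNamespace false -- summit = problem name (single-conjunct summit), D-0017

open Real Set MeasureTheory intervalIntegral
open Literature.MathematicalPhysics.QuantumLattice Literature.MathematicalPhysics.QuantumLattice.BandSectorCounting
open Literature.MathematicalPhysics.QuantumLattice.FermiRG Literature.Analysis.SpecialFunctions
open Summit.HubbardSuperconductivity.HubbardSuperconductivity.Theorems.KLRegimeSplit
open Summit.HubbardSuperconductivity.HubbardSuperconductivity.Theorems.DispersionFlow
open Summit.HubbardSuperconductivity.HubbardSuperconductivity.Theorems.PerturbedFermiCurve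

section Sizes

variable {K : TrigPolyC4v} {A : ℝ} (hA : ∀ p : Momentum, ∀ j ≤ 2, ‖iteratedFDeriv ℝ j (frameShift K) p‖ ≤ A) (hA20 : A ≤ 1 / 20)
  (hd : klCurveD ≤ (bandBounds (show (-4 : ℝ) < -1.1 by norm_num) (show (-1.1 : ℝ) ≤ -0.1 by norm_num)
    (show (-0.1 : ℝ) < 0 by norm_num)).Dtmin - 2 * A)
  {μ r : ℝ} (hr : 0 < r) (hlo : (-1.1 : ℝ) < μ - r - A) (hhi : μ + r + A < -0.1)
  {A₃ A₄ : ℝ} (hA₃ : ∀ p : Momentum, ‖iteratedFDeriv ℝ 3 (frameShift K) p‖ ≤ A₃)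
  (hA₄ : ∀ p : Momentum, ‖iteratedFDeriv ℝ 4 (frameShift K) p‖ ≤ A₄)
  {K₁ K₂ K₃ : ℝ} (hK₁ : ∀ p : Momentum, ‖fderiv ℝ (frameLevel μ K) p‖ ≤ K₁) (hK₂ : ∀ p : Momentum, ‖iteratedFDeriv ℝ 2 (frameLevel μ K) p‖ ≤ K₂)
  (hK₃ : ∀ p : Momentum, ‖iteratedFDeriv ℝ 3 (frameLevel μ K) p‖ ≤ K₃)
include hA hA20 hd hr hlo hhi hA₃ hA₄ hK₁ hK₂ hK₃

set_option maxHeartbeats 400000 in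
/-- **THE HYBRID LOOP-CIRCLE HEADLINE FOR `M_s` AT THE CONCRETE SPLIT PROFILE — kernel inputs `βT Λ B₁ B₂ B₃ t₁ lo hi` only**: `umkLoopCircle_integral_ppMidS_le_canonical` at `sκ := ppSplitProfile t₁` (`ppSplitProfile_admissible`, `ppSplitProfile_admissible_mid`: κ₀ = 1, κ₁ = 6/t₁, κ₂ = 8388608/t₁²,
flat below `t₁/2`) and `C := Cᴹ(B₁,B₂,B₃,t₁)` (`ppSplit_rowConstsMidS`).  Kernel inputs left: `0 < βT`, `0 < Λ`, `|χ′| ≤ B₁`, `|χ″| ≤ B₂`, `|χ‴| ≤ B₃`, `0 < t₁ ≤ 2/5`,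
`lo ≤ Λ`; the law's own rows verbatim. [cite: BenfattoGiulianiMastropietro2006, §2.4 (2.36)] [cite: FeldmanSalmhoferTrubowitz1998, §3] -/
theorem umkLoopCircle_integral_ppMidSSplit_le_canonical {R : RenConsts} {U : ℝ} {N : ℕ} (hF : FrameOK R U N μ K) {Kc r₀ g₀ w : ℝ} (hG : GeomConstants (frameLevel μ K) Kc r₀ g₀ w)
    {ρ : ℝ} (hρ : |ρ| < r) (hρ₀ : |ρ| < 3 / 80) (θ : ℝ) {Nt J : ℕ} (hJ : 2 ≤ J)
    {α₀ ℓ v₀ τ₀ lo hi Wφ Wm Δ K₀ Y₀ Y₁ YL W Afl Bfl Mρ Γ Γ' η₀ Δc ω d₁ lam eps κ₀ s₀ τ₁ s₁ : ℝ} {Y : ℝ → ℝ → ℝ → ℝ} {wt : ℝ → ℝ}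
    {βT Λ B₁ B₂ B₃ : ℝ} (hkβ : 0 < βT) (hkΛ : 0 < Λ) (hkB₁ : ∀ x, |deriv salmhoferCutoff x| ≤ B₁) (hkB₂ : ∀ x, |deriv (deriv salmhoferCutoff) x| ≤ B₂)
    (hkB₃ : ∀ x, |deriv (deriv (deriv salmhoferCutoff)) x| ≤ B₃)
    {t₁ : ℝ} (hkt₀ : 0 < t₁) (hkt25 : t₁ ≤ 2 / 5)
    (hkloΛ : lo ≤ Λ) {W' : ℝ} (hW' : 0 ≤ W') (hwL : ∀ e ∈ Icc lo hi, |wt e - wt lo| ≤ W' * (e - lo))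
    (hℓ : 0 ≤ ℓ) (hWm : 0 ≤ Wm) (hMρ : (32 * ((1 + 2 * 1) * (64 * B₂ + 120 * B₁ + 154) + (2 * (6 / t₁)) * (12 * B₁ + 9)) * (Λ / lo) ^ 3 +
          32 * ((1 + 2 * 1) * ((βT * lo) ^ 2 + 2) + (2 * (6 / t₁)) * (βT * lo + 1)) / (βT * lo) ^ 3) / ((1 + 2 * 1) * (12 * B₁ + 9) +
      ((1 + 2 * 1) * (128 * B₂ + 216 * B₁ + 294 + (48 * B₁ + 28) * ((2 - t₁) / t₁)) + 2 * (6 / t₁) * (12 * B₁ + 9)) +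
      ((1 + 2 * 1) * (512 * B₃ + 1664 * B₂ + 5280 * B₁ + 3424 + (256 * B₂ + 384 * B₁ + 504) * ((2 - t₁) / t₁) ^ 2 + (192 * B₁ + 112) * ((2 - t₁) / t₁)) +
          4 * (6 / t₁) * (128 * B₂ + 216 * B₁ + 294 + (48 * B₁ + 28) * ((2 - t₁) / t₁)) +
          (12 * B₁ + 9) * (2 * (8388608 / t₁ ^ 2) + 2 * (6 / t₁) * ((2 - t₁) / t₁ + 2))) +
      ((1 + 2 * 1) * (128 * B₁ + 72) + 16 * (6 / t₁))) ≤ Mρ)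
    (hmod : K₃ * (τ₀ + msD A₃ A₄ 1 * (ℓ) +
              hi / ((bandBounds (show (-4 : ℝ) < -1.1 by norm_num) (show (-1.1 : ℝ) ≤ -0.1 by norm_num) (show (-0.1 : ℝ) < 0 by norm_num)).Dtmin - 2 * A) +
              msD A₃ A₄ 1 * Wφ) * msD A₃ A₄ 1 ^ 2 +
          K₂ * (radialRowOneConst A ((bandBounds (show (-4 : ℝ) < -1.1 by norm_num) (show (-1.1 : ℝ) ≤ -0.1 by norm_num) (show (-0.1 : ℝ) < 0 by norm_num)).Dtmin -
                2 * A) * hi + msD A₃ A₄ 2 * Wφ) * (msD A₃ A₄ 1 + msD A₃ A₄ 1) +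
          K₂ * (τ₀ + msD A₃ A₄ 1 * (ℓ) +
              hi / ((bandBounds (show (-4 : ℝ) < -1.1 by norm_num) (show (-1.1 : ℝ) ≤ -0.1 by norm_num) (show (-0.1 : ℝ) < 0 by norm_num)).Dtmin - 2 * A) +
              msD A₃ A₄ 1 * Wφ) * msD A₃ A₄ 2 +
          K₁ * ((uRowTwoConst A A₃ ((bandBounds (show (-4 : ℝ) < -1.1 by norm_num) (show (-1.1 : ℝ) ≤ -0.1 by norm_num) (show (-0.1 : ℝ) < 0 by norm_num)).Dtmin -
                  2 * A) +
                1 / ((bandBounds (show (-4 : ℝ) < -1.1 by norm_num) (show (-1.1 : ℝ) ≤ -0.1 by norm_num) (show (-0.1 : ℝ) < 0 by norm_num)).Dtmin - 2 * A) +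
                2 * (radialRowOneConst A ((bandBounds (show (-4 : ℝ) < -1.1 by norm_num) (show (-1.1 : ℝ) ≤ -0.1 by norm_num)
                    (show (-0.1 : ℝ) < 0 by norm_num)).Dtmin - 2 * A) -
                  1 / ((bandBounds (show (-4 : ℝ) < -1.1 by norm_num) (show (-1.1 : ℝ) ≤ -0.1 by norm_num) (show (-0.1 : ℝ) < 0 by norm_num)).Dtmin - 2 * A))) *
              hi + msD A₃ A₄ 3 * Wφ) ≤
        w * (bandBounds (show (-4 : ℝ) < -1.1 by norm_num) (show (-1.1 : ℝ) ≤ -0.1 by norm_num) (show (-0.1 : ℝ) < 0 by norm_num)).umin ^ 2)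
    (hsl : K₂ * msD A₃ A₄ 1 * (τ₀ + msD A₃ A₄ 1 * (ℓ) +
        2 * (hi / ((bandBounds (show (-4 : ℝ) < -1.1 by norm_num) (show (-1.1 : ℝ) ≤ -0.1 by norm_num) (show (-0.1 : ℝ) < 0 by norm_num)).Dtmin - 2 * A))) ≤
      w * (bandBounds (show (-4 : ℝ) < -1.1 by norm_num) (show (-1.1 : ℝ) ≤ -0.1 by norm_num) (show (-0.1 : ℝ) < 0 by norm_num)).umin ^ 2 * Wm)
    (hrt : K₂ * (τ₀ + msD A₃ A₄ 1 * (ℓ) +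
          2 * (hi / ((bandBounds (show (-4 : ℝ) < -1.1 by norm_num) (show (-1.1 : ℝ) ≤ -0.1 by norm_num) (show (-0.1 : ℝ) < 0 by norm_num)).Dtmin - 2 * A) +
            msD A₃ A₄ 1 * Wφ)) /
        ((bandBounds (show (-4 : ℝ) < -1.1 by norm_num) (show (-1.1 : ℝ) ≤ -0.1 by norm_num) (show (-0.1 : ℝ) < 0 by norm_num)).Dtmin - 2 * A) ≤ 1 / 2)
    (hlo0 : 0 < lo) (hlohi : lo ≤ hi) (hhir : hi < r) (hW : 0 ≤ W) (hAfl : W * (65 + 32 * ((2 - t₁) / t₁) * (Λ + lo) / lo + (12 * (1 + 2 * 1) / βT + 4 * (6 / t₁) * ((2 - t₁) / t₁) * lo + (1 + 2 * 1) * hi) / (((1 + 2 * 1) * (12 * B₁ + 9) +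
      ((1 + 2 * 1) * (128 * B₂ + 216 * B₁ + 294 + (48 * B₁ + 28) * ((2 - t₁) / t₁)) + 2 * (6 / t₁) * (12 * B₁ + 9)) +
      ((1 + 2 * 1) * (512 * B₃ + 1664 * B₂ + 5280 * B₁ + 3424 + (256 * B₂ + 384 * B₁ + 504) * ((2 - t₁) / t₁) ^ 2 + (192 * B₁ + 112) * ((2 - t₁) / t₁)) +
          4 * (6 / t₁) * (128 * B₂ + 216 * B₁ + 294 + (48 * B₁ + 28) * ((2 - t₁) / t₁)) +
          (12 * B₁ + 9) * (2 * (8388608 / t₁ ^ 2) + 2 * (6 / t₁) * ((2 - t₁) / t₁ + 2))) +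
      ((1 + 2 * 1) * (128 * B₁ + 72) + 16 * (6 / t₁))) * lo)) ≤ Afl)
    (hBfl : 4 * (2 * ((2 - t₁) / t₁) + 3 / 2) * W' ≤ Bfl)
    (hK₀ : ∀ p : Momentum, |frameLevel μ K p| ≤ K₀) (hK₀pos : 0 < K₀) (hΓ₁ : K₀ ≤ Γ) (hΓ₂ : hi / 2 ≤ Γ) (hΓ'₁ : K₀ ≤ Γ')
    (hΔ : τ₀ + msD A₃ A₄ 1 * (ℓ) + 2 * (msD A₃ A₄ 1 * Wφ) ≤ Δ) (hΔ1 : Δ ≤ 3 / 10) (hΔu : Δ ≤ (bandBounds (show (-4 : ℝ) < -1.1 by norm_num) (show (-1.1 : ℝ) ≤ -0.1 by norm_num) (show (-0.1 : ℝ) < 0 by norm_num)).umin) (hΔr : K₁ * Δ < r) (hDfl : K₁ * Δ ≤ hi / t₁)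
    (hwc : ContinuousOn wt (Icc (-hi) hi)) (hw0 : ∀ e ∈ Icc (-hi) hi, 0 ≤ wt e) (hwW : ∀ e ∈ Icc (-hi) hi, wt e ≤ W)
    (hsame : τ₀ + 2 * (msD A₃ A₄ 1 * η₀ + |ρ| / ((bandBounds (show (-4 : ℝ) < -1.1 by norm_num) (show (-1.1 : ℝ) ≤ -0.1 by norm_num) (show (-0.1 : ℝ) < 0 by norm_num)).Dtmin - 2 * A)) ≤ 3 / 5)
    (hΔc1 : Δc ≤ 3 / 10) (hΔcr : K₁ * Δc < r) (hω₁ : η₀ + (ℓ) ≤ ω)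
    (hΓ : 2 / π * (((bandBounds (show (-4 : ℝ) < -1.1 by norm_num) (show (-1.1 : ℝ) ≤ -0.1 by norm_num) (show (-0.1 : ℝ) < 0 by norm_num)).Dtmin - 2 * A) * (bandBounds (show (-4 : ℝ) < -1.1 by norm_num) (show (-1.1 : ℝ) ≤ -0.1 by norm_num) (show (-0.1 : ℝ) < 0 by norm_num)).umin) *
      ((bandBounds (show (-4 : ℝ) < -1.1 by norm_num) (show (-1.1 : ℝ) ≤ -0.1 by norm_num) (show (-0.1 : ℝ) < 0 by norm_num)).umin * (3 / 200) / (4 + 2 * A) * (η₀ - (ℓ) - π / (2 * (bandBounds (show (-4 : ℝ) < -1.1 by norm_num) (show (-1.1 : ℝ) ≤ -0.1 by norm_num) (show (-0.1 : ℝ) < 0 by norm_num)).umin) * Δc) - π * 7 * (K₁ * Δc + |ρ|) / ((bandBounds (show (-4 : ℝ) < -1.1 by norm_num) (show (-1.1 : ℝ) ≤ -0.1 by norm_num) (show (-0.1 : ℝ) < 0 by norm_num)).Dtmin - 2 * A) ^ 2) * (ℓ) ≤ Γ)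
    (hhir₀ : hi < r₀) (hhiK : hi ≤ K₀) (hd₁ : 0 < d₁) (hlam : 0 < lam)
    (hhid : K₁ * (hi / ((bandBounds (show (-4 : ℝ) < -1.1 by norm_num) (show (-1.1 : ℝ) ≤ -0.1 by norm_num) (show (-0.1 : ℝ) < 0 by norm_num)).Dtmin - 2 * A)) ≤ d₁ / 2)
    (hepsr : eps ≤ r)
    (hT : KlwjCertB)
    (hτ₀ : msD A₃ A₄ 1 *
            ((π / 2 * lam /
                  (((bandBounds (show (-4 : ℝ) < -1.1 by norm_num) (show (-1.1 : ℝ) ≤ -0.1 by norm_num) (show (-0.1 : ℝ) < 0 by norm_num)).Dtmin -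
                      2 * A) *
                    (bandBounds (show (-4 : ℝ) < -1.1 by norm_num) (show (-1.1 : ℝ) ≤ -0.1 by norm_num) (show (-0.1 : ℝ) < 0 by norm_num)).umin) +
                π * Kc * eps / ((bandBounds (show (-4 : ℝ) < -1.1 by norm_num) (show (-1.1 : ℝ) ≤ -0.1 by norm_num) (show (-0.1 : ℝ) < 0 by norm_num)).Dtmin - 2 * A) ^ 2) /
              ((bandBounds (show (-4 : ℝ) < -1.1 by norm_num) (show (-1.1 : ℝ) ≤ -0.1 by norm_num) (show (-0.1 : ℝ) < 0 by norm_num)).umin * w /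
                (4 + 2 * A))) +
          (2 * hi + eps) / ((bandBounds (show (-4 : ℝ) < -1.1 by norm_num) (show (-1.1 : ℝ) ≤ -0.1 by norm_num) (show (-0.1 : ℝ) < 0 by norm_num)).Dtmin -
            2 * A) ≤ τ₀)
    (hκ₀ : 0 < κ₀) (hκ₀le : κ₀ ≤ 2 / π * (((bandBounds (show (-4 : ℝ) < -1.1 by norm_num) (show (-1.1 : ℝ) ≤ -0.1 by norm_num) (show (-0.1 : ℝ) < 0 by norm_num)).Dtmin - 2 * A) * (bandBounds (show (-4 : ℝ) < -1.1 by norm_num) (show (-1.1 : ℝ) ≤ -0.1 by norm_num) (show (-0.1 : ℝ) < 0 by norm_num)).umin) *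
      ((bandBounds (show (-4 : ℝ) < -1.1 by norm_num) (show (-1.1 : ℝ) ≤ -0.1 by norm_num) (show (-0.1 : ℝ) < 0 by norm_num)).umin * (3 / 200) / (4 + 2 * A) * (η₀ - (ℓ) - π / (2 * (bandBounds (show (-4 : ℝ) < -1.1 by norm_num) (show (-1.1 : ℝ) ≤ -0.1 by norm_num) (show (-0.1 : ℝ) < 0 by norm_num)).umin) * Δc) - π * 7 * (K₁ * Δc + |ρ|) / ((bandBounds (show (-4 : ℝ) < -1.1 by norm_num) (show (-1.1 : ℝ) ≤ -0.1 by norm_num) (show (-0.1 : ℝ) < 0 by norm_num)).Dtmin - 2 * A) ^ 2))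
    (hs₀ : 0 < s₀) (hs₀le : s₀ ≤ 9 / 400 * (bandBounds (show (-4 : ℝ) < -1.1 by norm_num) (show (-1.1 : ℝ) ≤ -0.1 by norm_num) (show (-0.1 : ℝ) < 0 by norm_num)).umin ^ 2 - 2 * (2 * K₃ * Δc * msD A₃ A₄ 1 ^ 2 +
        4 * K₂ * (radialRowOneConst A ((bandBounds (show (-4 : ℝ) < -1.1 by norm_num) (show (-1.1 : ℝ) ≤ -0.1 by norm_num) (show (-0.1 : ℝ) < 0 by norm_num)).Dtmin - 2 * A) * |ρ| + msD A₃ A₄ 2 * ω) * msD A₃ A₄ 1 +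
        K₂ * Δc * msD A₃ A₄ 2 +
        K₁ * ((uRowTwoConst A A₃ ((bandBounds (show (-4 : ℝ) < -1.1 by norm_num) (show (-1.1 : ℝ) ≤ -0.1 by norm_num) (show (-0.1 : ℝ) < 0 by norm_num)).Dtmin - 2 * A) + 1 / ((bandBounds (show (-4 : ℝ) < -1.1 by norm_num) (show (-1.1 : ℝ) ≤ -0.1 by norm_num) (show (-0.1 : ℝ) < 0 by norm_num)).Dtmin - 2 * A) +
              2 * (radialRowOneConst A ((bandBounds (show (-4 : ℝ) < -1.1 by norm_num) (show (-1.1 : ℝ) ≤ -0.1 by norm_num) (show (-0.1 : ℝ) < 0 by norm_num)).Dtmin - 2 * A) - 1 / ((bandBounds (show (-4 : ℝ) < -1.1 by norm_num) (show (-1.1 : ℝ) ≤ -0.1 by norm_num) (show (-0.1 : ℝ) < 0 by norm_num)).Dtmin - 2 * A))) * |ρ| + msD A₃ A₄ 3 * ω)))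
    (hτ₁ : τ₀ + msD A₃ A₄ 1 * (ℓ + 2 * (4 * (2 * π / J))) ≤ τ₁)
    (hYnull : ∀ ϑ ∈ Icc α₀ (α₀ + Nt * ℓ), ∀ e ∈ Icc (-hi) hi, ∀ v, ‖pairSumPath μ K ρ ϑ θ 0 - (2 : ℝ) • levelPoint μ K 0 (v + θ)‖ ≤ τ₁ → Y ϑ e v = 0)
    (hs₁ : msD A₃ A₄ 1 *
            ((π / 2 * lam /
                  (((bandBounds (show (-4 : ℝ) < -1.1 by norm_num) (show (-1.1 : ℝ) ≤ -0.1 by norm_num) (show (-0.1 : ℝ) < 0 by norm_num)).Dtmin -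
                      2 * A) *
                    (bandBounds (show (-4 : ℝ) < -1.1 by norm_num) (show (-1.1 : ℝ) ≤ -0.1 by norm_num) (show (-0.1 : ℝ) < 0 by norm_num)).umin) +
                π * Kc * eps / ((bandBounds (show (-4 : ℝ) < -1.1 by norm_num) (show (-1.1 : ℝ) ≤ -0.1 by norm_num) (show (-0.1 : ℝ) < 0 by norm_num)).Dtmin - 2 * A) ^ 2) /
              ((bandBounds (show (-4 : ℝ) < -1.1 by norm_num) (show (-1.1 : ℝ) ≤ -0.1 by norm_num) (show (-0.1 : ℝ) < 0 by norm_num)).umin * w /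
                (4 + 2 * A))) +
          eps / ((bandBounds (show (-4 : ℝ) < -1.1 by norm_num) (show (-1.1 : ℝ) ≤ -0.1 by norm_num) (show (-0.1 : ℝ) < 0 by norm_num)).Dtmin - 2 * A) + msD A₃ A₄ 1 * ℓ ≤ s₁)
    (hCnull : ∀ ϑ ∈ Icc α₀ (α₀ + Nt * ℓ), ∀ e ∈ Icc (-hi) hi, ∀ v, ‖pairSumPath μ K ρ ϑ θ 0‖ ≤ s₁ → Y ϑ e v = 0)
    (hWφ : (4 * (2 * π / J)) + 2 * Wm ≤ Wφ) (hΓ'₂ : w * (bandBounds (show (-4 : ℝ) < -1.1 by norm_num) (show (-1.1 : ℝ) ≤ -0.1 by norm_num) (show (-0.1 : ℝ) < 0 by norm_num)).umin ^ 2 / 2 * ((4 * (2 * π / J)) + 2 * Wm) ^ 2 ≤ Γ')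
    (hΔc : τ₀ + msD A₃ A₄ 1 * ((ℓ) + ((4 * (2 * π / J)) + 2 * Wm)) ≤ Δc) (hω₂ : (4 * (2 * π / J)) + 2 * Wm ≤ ω)
    (heps : d₁ + K₁ * (msD A₃ A₄ 1 * ((4 * (2 * π / J)))) + K₁ * (hi / ((bandBounds (show (-4 : ℝ) < -1.1 by norm_num) (show (-1.1 : ℝ) ≤ -0.1 by norm_num) (show (-0.1 : ℝ) < 0 by norm_num)).Dtmin - 2 * A)) + hi ≤ eps)
   
   
    (hY₀ : 0 ≤ Y₀) (hY₁ : 0 ≤ Y₁) (hYL : 0 ≤ YL) (hYd : ∀ ϑ, ∀ e ∈ Icc (-hi) hi, ContDiff ℝ 1 (Y ϑ e))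
    (hY3 : ContinuousOn (fun p : ℝ × ℝ × ℝ => Y p.1 p.2.1 p.2.2) (univ ×ˢ (Icc (-hi) hi ×ˢ univ)))
    (hYb : ∀ ϑ, ∀ e ∈ Icc (-hi) hi, ∀ v, |Y ϑ e v| ≤ Y₀) (hY1 : ∀ ϑ, ∀ e ∈ Icc (-hi) hi, ∀ v, |deriv (Y ϑ e) v| ≤ Y₁)
    (hYLip : ∀ ϑ, ∀ e ∈ Icc lo hi, ∀ v, |Y ϑ e v - Y ϑ lo v| ≤ YL * |e - lo|) (hYper : ∀ ϑ, ∀ e ∈ Icc (-hi) hi, ∀ v, Y ϑ e (v + 2 * π) = Y ϑ e v) :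
    ∫ ϑ in α₀..(α₀ + Nt * ℓ), |∫ e in (-hi)..hi, ∫ v in v₀..(v₀ + 2 * π), wt e * (Y ϑ e v * deriv (fun v : ℝ => ppMidKernelS βT Λ (ppSplitProfile t₁) lo e v / ((1 + 2 * 1) * (12 * B₁ + 9) +
      ((1 + 2 * 1) * (128 * B₂ + 216 * B₁ + 294 + (48 * B₁ + 28) * ((2 - t₁) / t₁)) + 2 * (6 / t₁) * (12 * B₁ + 9)) +
      ((1 + 2 * 1) * (512 * B₃ + 1664 * B₂ + 5280 * B₁ + 3424 + (256 * B₂ + 384 * B₁ + 504) * ((2 - t₁) / t₁) ^ 2 + (192 * B₁ + 112) * ((2 - t₁) / t₁)) +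
          4 * (6 / t₁) * (128 * B₂ + 216 * B₁ + 294 + (48 * B₁ + 28) * ((2 - t₁) / t₁)) +
          (12 * B₁ + 9) * (2 * (8388608 / t₁ ^ 2) + 2 * (6 / t₁) * ((2 - t₁) / t₁ + 2))) +
      ((1 + 2 * 1) * (128 * B₁ + 72) + 16 * (6 / t₁)))) (frameLevel μ K (pairSumPath μ K ρ ϑ θ 0 - levelPoint μ K e (v + θ))))| ≤ (J : ℝ) * ((Nt : ℝ) * max (max (2 * ((2 * (      3 * W * ((4 + 2 * (3 / 2 : ℝ) + 1 / 2) / (1 / 2)) *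
          (Y₀ * (4 / Real.sqrt (2 * (K₂ * msD A₃ A₄ 1 ^ 2) +
                    w * (bandBounds (show (-4 : ℝ) < -1.1 by norm_num) (show (-1.1 : ℝ) ≤ -0.1 by norm_num) (show (-0.1 : ℝ) < 0 by norm_num)).umin ^ 2) +
                  16 * Real.sqrt (2 * (K₂ * msD A₃ A₄ 1 ^ 2) +
                        w * (bandBounds (show (-4 : ℝ) < -1.1 by norm_num) (show (-1.1 : ℝ) ≤ -0.1 by norm_num) (show (-0.1 : ℝ) < 0 by norm_num)).umin ^ 2) /
                      (w * (bandBounds (show (-4 : ℝ) < -1.1 by norm_num) (show (-1.1 : ℝ) ≤ -0.1 by norm_num) (show (-0.1 : ℝ) < 0 by norm_num)).umin ^ 2) +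
                  64 * (2 * (K₂ * msD A₃ A₄ 1 ^ 2) +
                          w * (bandBounds (show (-4 : ℝ) < -1.1 by norm_num) (show (-1.1 : ℝ) ≤ -0.1 by norm_num) (show (-0.1 : ℝ) < 0 by norm_num)).umin ^ 2) ^ 2 *
                      Real.sqrt (2 * (K₂ * msD A₃ A₄ 1 ^ 2) +
                          w * (bandBounds (show (-4 : ℝ) < -1.1 by norm_num) (show (-1.1 : ℝ) ≤ -0.1 by norm_num) (show (-0.1 : ℝ) < 0 by norm_num)).umin ^ 2) /
                    (w * (bandBounds (show (-4 : ℝ) < -1.1 by norm_num) (show (-1.1 : ℝ) ≤ -0.1 by norm_num) (show (-0.1 : ℝ) < 0 by norm_num)).umin ^ 2) ^ 3) *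
              Real.sqrt (4 + 2 * (3 / 2 : ℝ) + 1 / 2) +
            32 * (Y₁ + Y₀ * (6 / (2 * π / J))) * (2 * (K₂ * msD A₃ A₄ 1 ^ 2) +
                  w * (bandBounds (show (-4 : ℝ) < -1.1 by norm_num) (show (-1.1 : ℝ) ≤ -0.1 by norm_num) (show (-0.1 : ℝ) < 0 by norm_num)).umin ^ 2) /
              (w * (bandBounds (show (-4 : ℝ) < -1.1 by norm_num) (show (-1.1 : ℝ) ≤ -0.1 by norm_num) (show (-0.1 : ℝ) < 0 by norm_num)).umin ^ 2) ^ 2))) * max 1 (Real.sqrt (κ₀))⁻¹ * (81 * (Γ / (κ₀)) ^ (1 / 4 : ℝ)) *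
          ((ℓ) ^ (3 / 4 : ℝ) / (3 / 4) + (ℓ) ^ (1 / 4 : ℝ) / (1 / 4))))
      ((8 * (32 * (Y₀ * Afl + W * Y₀ * ((8 * ((2 - t₁) / t₁) * (Λ / lo) * ((1 + 2 * 1) * (128 * B₂ + 216 * B₁ + 294 + (48 * B₁ + 28) * ((2 - t₁) / t₁)) + 2 * (6 / t₁) * (12 * B₁ + 9)) +
          ((1 + 2 * 1) * (48 * ((2 - t₁) / t₁) ^ 3) + 16 * (6 / t₁) * ((2 - t₁) / t₁) ^ 2) / (βT * lo)) / ((1 + 2 * 1) * (12 * B₁ + 9) +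
      ((1 + 2 * 1) * (128 * B₂ + 216 * B₁ + 294 + (48 * B₁ + 28) * ((2 - t₁) / t₁)) + 2 * (6 / t₁) * (12 * B₁ + 9)) +
      ((1 + 2 * 1) * (512 * B₃ + 1664 * B₂ + 5280 * B₁ + 3424 + (256 * B₂ + 384 * B₁ + 504) * ((2 - t₁) / t₁) ^ 2 + (192 * B₁ + 112) * ((2 - t₁) / t₁)) +
          4 * (6 / t₁) * (128 * B₂ + 216 * B₁ + 294 + (48 * B₁ + 28) * ((2 - t₁) / t₁)) +
          (12 * B₁ + 9) * (2 * (8388608 / t₁ ^ 2) + 2 * (6 / t₁) * ((2 - t₁) / t₁ + 2))) +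
      ((1 + 2 * 1) * (128 * B₁ + 72) + 16 * (6 / t₁)))) + 5 * (W * Y₀ * Mρ) + 32 * (W * Y₀)) / (3 * Real.sqrt (w * (bandBounds (show (-4 : ℝ) < -1.1 by norm_num) (show (-1.1 : ℝ) ≤ -0.1 by norm_num) (show (-0.1 : ℝ) < 0 by norm_num)).umin ^ 2 / 2))) + 4 * (2 * (      W * (Y₀ * (4 / Real.sqrt (2 * (K₂ * msD A₃ A₄ 1 ^ 2) +
                    w * (bandBounds (show (-4 : ℝ) < -1.1 by norm_num) (show (-1.1 : ℝ) ≤ -0.1 by norm_num) (show (-0.1 : ℝ) < 0 by norm_num)).umin ^ 2) + 16 * Real.sqrt (2 * (K₂ * msD A₃ A₄ 1 ^ 2) +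
                    w * (bandBounds (show (-4 : ℝ) < -1.1 by norm_num) (show (-1.1 : ℝ) ≤ -0.1 by norm_num) (show (-0.1 : ℝ) < 0 by norm_num)).umin ^ 2) / (w * (bandBounds (show (-4 : ℝ) < -1.1 by norm_num) (show (-1.1 : ℝ) ≤ -0.1 by norm_num) (show (-0.1 : ℝ) < 0 by norm_num)).umin ^ 2) + 64 * (2 * (K₂ * msD A₃ A₄ 1 ^ 2) +
                    w * (bandBounds (show (-4 : ℝ) < -1.1 by norm_num) (show (-1.1 : ℝ) ≤ -0.1 by norm_num) (show (-0.1 : ℝ) < 0 by norm_num)).umin ^ 2) ^ 2 * Real.sqrt (2 * (K₂ * msD A₃ A₄ 1 ^ 2) +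
                    w * (bandBounds (show (-4 : ℝ) < -1.1 by norm_num) (show (-1.1 : ℝ) ≤ -0.1 by norm_num) (show (-0.1 : ℝ) < 0 by norm_num)).umin ^ 2) / (w * (bandBounds (show (-4 : ℝ) < -1.1 by norm_num) (show (-1.1 : ℝ) ≤ -0.1 by norm_num) (show (-0.1 : ℝ) < 0 by norm_num)).umin ^ 2) ^ 3 +
              2 * Real.sqrt (w * (bandBounds (show (-4 : ℝ) < -1.1 by norm_num) (show (-1.1 : ℝ) ≤ -0.1 by norm_num) (show (-0.1 : ℝ) < 0 by norm_num)).umin ^ 2) / (w * (bandBounds (show (-4 : ℝ) < -1.1 by norm_num) (show (-1.1 : ℝ) ≤ -0.1 by norm_num) (show (-0.1 : ℝ) < 0 by norm_num)).umin ^ 2) + (2 * (K₂ * msD A₃ A₄ 1 ^ 2) +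
                    w * (bandBounds (show (-4 : ℝ) < -1.1 by norm_num) (show (-1.1 : ℝ) ≤ -0.1 by norm_num) (show (-0.1 : ℝ) < 0 by norm_num)).umin ^ 2) * Real.sqrt (w * (bandBounds (show (-4 : ℝ) < -1.1 by norm_num) (show (-1.1 : ℝ) ≤ -0.1 by norm_num) (show (-0.1 : ℝ) < 0 by norm_num)).umin ^ 2) / (w * (bandBounds (show (-4 : ℝ) < -1.1 by norm_num) (show (-1.1 : ℝ) ≤ -0.1 by norm_num) (show (-0.1 : ℝ) < 0 by norm_num)).umin ^ 2) ^ 2) +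
            (Y₁ + Y₀ * (6 / (2 * π / J))) * (32 * (2 * (K₂ * msD A₃ A₄ 1 ^ 2) +
                    w * (bandBounds (show (-4 : ℝ) < -1.1 by norm_num) (show (-1.1 : ℝ) ≤ -0.1 by norm_num) (show (-0.1 : ℝ) < 0 by norm_num)).umin ^ 2) * Real.sqrt (K₀ + hi) / (w * (bandBounds (show (-4 : ℝ) < -1.1 by norm_num) (show (-1.1 : ℝ) ≤ -0.1 by norm_num) (show (-0.1 : ℝ) < 0 by norm_num)).umin ^ 2) ^ 2 + ((4 * (2 * π / J)) + 2 * Wm) * Real.sqrt (w * (bandBounds (show (-4 : ℝ) < -1.1 by norm_num) (show (-1.1 : ℝ) ≤ -0.1 by norm_num) (show (-0.1 : ℝ) < 0 by norm_num)).umin ^ 2) / (w * (bandBounds (show (-4 : ℝ) < -1.1 by norm_num) (show (-1.1 : ℝ) ≤ -0.1 by norm_num) (show (-0.1 : ℝ) < 0 by norm_num)).umin ^ 2))) *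
          ((4 + 2 * (3 / 2 : ℝ) + 1 / 2) * Real.sqrt (4 + 2 * (3 / 2 : ℝ) + 1 / 2) *
                ((1 + Real.log 2 + log⁺ ((1 + 4 * (2 * (K₂ * msD A₃ A₄ 1 ^ 2) +
                    w * (bandBounds (show (-4 : ℝ) < -1.1 by norm_num) (show (-1.1 : ℝ) ≤ -0.1 by norm_num) (show (-0.1 : ℝ) < 0 by norm_num)).umin ^ 2) / (w * (bandBounds (show (-4 : ℝ) < -1.1 by norm_num) (show (-1.1 : ℝ) ≤ -0.1 by norm_num) (show (-0.1 : ℝ) < 0 by norm_num)).umin ^ 2)) * (1 + (3 / 2 : ℝ))) + log⁺ (1 + 4 * (2 * (K₂ * msD A₃ A₄ 1 ^ 2) +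
                    w * (bandBounds (show (-4 : ℝ) < -1.1 by norm_num) (show (-1.1 : ℝ) ≤ -0.1 by norm_num) (show (-0.1 : ℝ) < 0 by norm_num)).umin ^ 2) / (w * (bandBounds (show (-4 : ℝ) < -1.1 by norm_num) (show (-1.1 : ℝ) ≤ -0.1 by norm_num) (show (-0.1 : ℝ) < 0 by norm_num)).umin ^ 2))) + 4) +
            2 * (1 + Real.log 2 + log⁺ ((1 + 4 * (2 * (K₂ * msD A₃ A₄ 1 ^ 2) +
                    w * (bandBounds (show (-4 : ℝ) < -1.1 by norm_num) (show (-1.1 : ℝ) ≤ -0.1 by norm_num) (show (-0.1 : ℝ) < 0 by norm_num)).umin ^ 2) / (w * (bandBounds (show (-4 : ℝ) < -1.1 by norm_num) (show (-1.1 : ℝ) ≤ -0.1 by norm_num) (show (-0.1 : ℝ) < 0 by norm_num)).umin ^ 2)) * (1 + (3 / 2 : ℝ))) + log⁺ (1 + 4 * (2 * (K₂ * msD A₃ A₄ 1 ^ 2) +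
                    w * (bandBounds (show (-4 : ℝ) < -1.1 by norm_num) (show (-1.1 : ℝ) ≤ -0.1 by norm_num) (show (-0.1 : ℝ) < 0 by norm_num)).umin ^ 2) / (w * (bandBounds (show (-4 : ℝ) < -1.1 by norm_num) (show (-1.1 : ℝ) ≤ -0.1 by norm_num) (show (-0.1 : ℝ) < 0 by norm_num)).umin ^ 2))) *
              ((4 + 2 * (3 / 2 : ℝ) + 1 / 2) / (1 / 2) * Real.sqrt ((4 + 2 * (3 / 2 : ℝ) + 1 / 2) / (1 / 2))))))) / Real.sqrt ((s₀) / 2) + (((16 * ((2 * ((2 - t₁) / t₁)) + 3 / 2) ^ 3 * W * Y₀ * (K₂ / ((bandBounds (show (-4 : ℝ) < -1.1 by norm_num) (show (-1.1 : ℝ) ≤ -0.1 by norm_num) (show (-0.1 : ℝ) < 0 by norm_num)).Dtmin - 2 * A)) * (1 / ((bandBounds (show (-4 : ℝ) < -1.1 by norm_num) (show (-1.1 : ℝ) ≤ -0.1 by norm_num) (show (-0.1 : ℝ) < 0 by norm_num)).Dtmin - 2 * A) + msD A₃ A₄ 1 * (π * (4 + 2 * A) * Kc / ((bandBounds (show (-4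 : ℝ) < -1.1 by norm_num) (show (-1.1 : ℝ) ≤ -0.1 by norm_num) (show (-0.1 : ℝ) < 0 by norm_num)).umin * w * ((bandBounds (show (-4 : ℝ) < -1.1 by norm_num) (show (-1.1 : ℝ) ≤ -0.1 by norm_num) (show (-0.1 : ℝ) < 0 by norm_num)).Dtmin - 2 * A) ^ 2))) + 128 * ((2 * ((2 - t₁) / t₁)) + 3 / 2) ^ 3 * W * Y₀ * (K₂ / ((bandBounds (show (-4 : ℝ) < -1.1 by norm_num) (show (-1.1 : ℝ) ≤ -0.1 by norm_num) (show (-0.1 : ℝ) < 0 by norm_num)).Dtmin - 2 * A) ^ 2) + 16 * ((2 * ((2 - t₁) / t₁)) + 3 / 2) ^ 2 * W * YL + Y₀ * Bfl) * ((4 * (2 * π / J)) + 2 * Wm) +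
          8 * (32 * ((2 * ((2 - t₁) / t₁)) + 3 / 2) ^ 3 * W * Y₀ * (K₂ / ((bandBounds (show (-4 : ℝ) < -1.1 by norm_num) (show (-1.1 : ℝ) ≤ -0.1 by norm_num) (show (-0.1 : ℝ) < 0 by norm_num)).Dtmin - 2 * A)) * msD A₃ A₄ 1) /
            (w * (bandBounds (show (-4 : ℝ) < -1.1 by norm_num) (show (-1.1 : ℝ) ≤ -0.1 by norm_num) (show (-0.1 : ℝ) < 0 by norm_num)).umin ^ 2 / 2) * Real.log 2)) * (ℓ) +
        (4 * (32 * ((2 * ((2 - t₁) / t₁)) + 3 / 2) ^ 3 * W * Y₀ * (K₂ / ((bandBounds (show (-4 : ℝ) < -1.1 by norm_num) (show (-1.1 : ℝ) ≤ -0.1 by norm_num) (show (-0.1 : ℝ) < 0 by norm_num)).Dtmin - 2 * A)) * msD A₃ A₄ 1) /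
          (w * (bandBounds (show (-4 : ℝ) < -1.1 by norm_num) (show (-1.1 : ℝ) ≤ -0.1 by norm_num) (show (-0.1 : ℝ) < 0 by norm_num)).umin ^ 2 / 2)) * (2 * (Γ' / ((s₀) / 2)) ^ (1 / 4 : ℝ)) * (8 * Real.sqrt (ℓ))))
      (ℓ * max (2 * hi * (((4 * (2 * π / J))) * (W * Y₀ * (4 / d₁ ^ 2))))
        (W * ((Y₀ * ((K₂ * msD A₃ A₄ 1 ^ 2 + K₁ * msD A₃ A₄ 2) / lam ^ 2) + (Y₁ + Y₀ * (6 / (2 * π / J))) * lam⁻¹) * (lam⁻¹ * (4 * Real.sqrt K₀))) * (4 * Real.sqrt hi)))) := by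
  obtain ⟨h1, h2, h3, h4, h5, h6, h7, h8, h9⟩ := ppSplitProfile_admissible hkt₀
  obtain ⟨h10, h11, h12⟩ := ppSplitProfile_admissible_mid hkt₀
  obtain ⟨hC, hC0, hC1, hC2, hCs⟩ := ppSplit_rowConstsMidS (salmhoferB₁_nonneg hkB₁) (salmhoferB₂_nonneg hkB₂) ((abs_nonneg _).trans (hkB₃ 0)) hkt₀ hkt25
  have hB10 : 0 ≤ B₁ := salmhoferB₁_nonneg hkB₁
  have hB20 : 0 ≤ B₂ := salmhoferB₂_nonneg hkB₂
  have hhi0 : 0 < hi := hlo0.trans_le hlohi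
  obtain ⟨hqc, hCt, hAflle, hBflle, hMρle⟩ := ppMidKernelS_lawConsts (hi := hi) hkβ hkΛ hkB₁ hkB₂ h4 h5 hkt₀ hkt25 hlo0 hC hW hW' hhi0
  have hMρ0 : 0 ≤ Mρ := hMρle.trans hMρ
  have hAfl0 : 0 ≤ Afl := hAflle.trans hAfl
  have hBfl0 : 0 ≤ Bfl := hBflle.trans hBfl
  obtain ⟨rKd, rK2d, rK0, rK0s, rK1, rK2, rcomp, rKopp, rKc, rflatB, rKn1, rρ0, rρc, rρtail, rKs1⟩ :=
    ppMidKernelS_lawRows (hi := hi) hkβ hkΛ hkB₁ hkB₂ hkB₃ h1 h2 h3 h4 h5 h6 hkt₀ hkt25 h7 h8 h9 h10 h11 h12 hlo0 hkloΛ hC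
      hC0 hC1 hC2 hCs hlohi hwc hw0 hwW hW' hwL
  exact umkLoopCircle_integral_middle_le_canonical hA hA20 hd hr hlo hhi hA₃ hA₄ hK₁ hK₂ hK₃
    (Kr := fun e u => ppMidKernelS βT Λ (ppSplitProfile t₁) lo e u / ((1 + 2 * 1) * (12 * B₁ + 9) +
      ((1 + 2 * 1) * (128 * B₂ + 216 * B₁ + 294 + (48 * B₁ + 28) * ((2 - t₁) / t₁)) + 2 * (6 / t₁) * (12 * B₁ + 9)) +
      ((1 + 2 * 1) * (512 * B₃ + 1664 * B₂ + 5280 * B₁ + 3424 + (256 * B₂ + 384 * B₁ + 504) * ((2 - t₁) / t₁) ^ 2 + (192 * B₁ + 112) * ((2 - t₁) / t₁)) +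
          4 * (6 / t₁) * (128 * B₂ + 216 * B₁ + 294 + (48 * B₁ + 28) * ((2 - t₁) / t₁)) +
          (12 * B₁ + 9) * (2 * (8388608 / t₁ ^ 2) + 2 * (6 / t₁) * ((2 - t₁) / t₁ + 2))) +
      ((1 + 2 * 1) * (128 * B₁ + 72) + 16 * (6 / t₁)))) (qc := (2 * ((2 - t₁) / t₁))) (Dfl := hi / t₁)
    (Ct := ((8 * ((2 - t₁) / t₁) * (Λ / lo) * ((1 + 2 * (1 : ℝ)) * (128 * B₂ + 216 * B₁ + 294 + (48 * B₁ + 28) * ((2 - t₁) / t₁)) + 2 * (6 / t₁) * (12 * B₁ + 9)) +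
          ((1 + 2 * (1 : ℝ)) * (48 * ((2 - t₁) / t₁) ^ 3) + 16 * (6 / t₁) * ((2 - t₁) / t₁) ^ 2) / (βT * lo)) / ((1 + 2 * 1) * (12 * B₁ + 9) +
      ((1 + 2 * 1) * (128 * B₂ + 216 * B₁ + 294 + (48 * B₁ + 28) * ((2 - t₁) / t₁)) + 2 * (6 / t₁) * (12 * B₁ + 9)) +
      ((1 + 2 * 1) * (512 * B₃ + 1664 * B₂ + 5280 * B₁ + 3424 + (256 * B₂ + 384 * B₁ + 504) * ((2 - t₁) / t₁) ^ 2 + (192 * B₁ + 112) * ((2 - t₁) / t₁)) +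
          4 * (6 / t₁) * (128 * B₂ + 216 * B₁ + 294 + (48 * B₁ + 28) * ((2 - t₁) / t₁)) +
          (12 * B₁ + 9) * (2 * (8388608 / t₁ ^ 2) + 2 * (6 / t₁) * ((2 - t₁) / t₁ + 2))) +
      ((1 + 2 * 1) * (128 * B₁ + 72) + 16 * (6 / t₁)))))
    (ρm := fun s : ℝ => (64 * ((1 + 2 * (1 : ℝ)) * (64 * B₂ + 120 * B₁ + 154) + (2 * (6 / t₁)) * (12 * B₁ + 9)) * Λ ^ 3 / (s + 2 * Λ) ^ 3 +
          ((1 + 2 * (1 : ℝ)) * ((βT * lo) ^ 2 + 2) + (2 * (6 / t₁)) * (βT * lo + 1)) * Real.exp (-(βT / 2 * s))) / ((1 + 2 * 1) * (12 * B₁ + 9) +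
      ((1 + 2 * 1) * (128 * B₂ + 216 * B₁ + 294 + (48 * B₁ + 28) * ((2 - t₁) / t₁)) + 2 * (6 / t₁) * (12 * B₁ + 9)) +
      ((1 + 2 * 1) * (512 * B₃ + 1664 * B₂ + 5280 * B₁ + 3424 + (256 * B₂ + 384 * B₁ + 504) * ((2 - t₁) / t₁) ^ 2 + (192 * B₁ + 112) * ((2 - t₁) / t₁)) +
          4 * (6 / t₁) * (128 * B₂ + 216 * B₁ + 294 + (48 * B₁ + 28) * ((2 - t₁) / t₁)) +
          (12 * B₁ + 9) * (2 * (8388608 / t₁ ^ 2) + 2 * (6 / t₁) * ((2 - t₁) / t₁ + 2))) +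
      ((1 + 2 * 1) * (128 * B₁ + 72) + 16 * (6 / t₁))))
    hF
    hG
    hρ
    hρ₀
    θ
    hJ
    hℓ
    hWm
    hMρ0
    hmod
    hsl
    hrt
    hlo0
    hlohi
    hhir
    hqc
    hCt
    hW
    hAfl0
    hBfl0
    hK₀
    hK₀pos
    hΓ₁
    hΓ₂
    hΓ'₁
    hΔ
    hΔ1
    hΔu
    hΔr
    hDfl
    rKd
    rK2d
    rK0
    rK0s
    rK1
    rK2
    rcomp
    rKopp
    rKc
    (fun D hD hDle => (rflatB D hD hDle).trans (add_le_add (mul_le_mul_of_nonneg_right hAfl (by positivity)) hBfl))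
    rKn1
    rρ0
    rρc
    (fun a ha => (rρtail a ha).trans (mul_le_mul_of_nonneg_right hMρ (by have := ha.1; positivity)))
    rKs1
    hwc
    hw0
    hwW
    hsame
    hΔc1
    hΔcr
    hω₁
    hΓ
    hhir₀
    hhiK
    hd₁
    hlam
    hhid
    hepsr
    hT
    hτ₀
    hκ₀
    hκ₀le
    hs₀
    hs₀le
    hτ₁
    hYnull
    hs₁
    hCnull
    hWφ
    hΓ'₂
    hΔc
    hω₂
    heps
    hY₀
    hY₁
    hYL
    hYd
    hY3
    hYb
    hY1
    hYLip
    hYper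

end Sizes

end Summit.HubbardSuperconductivity.HubbardSuperconductivity.Theorems.C4a

end
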